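import Summits.KontsevichZagierPeriods.KontsevichZagierPeriods.Theorems.CommonUnfoldingPeakNormalFormKlInterchange

/-!
# `PeakNormalForm` (stmt-KontsevichZagierPeriods-4828, route CommonUnfolding, rank 2) — line `KlInterchange`
# (forward rung G1 over `InterchangeLemma`, seed g1-KontsevichZagierPeriods-4830; harvested 2026-08-17): the `k × l` INTERCHANGE

Forward discipline (G1 next-rung). This line does NOT attack the crux head-on. It records, as a
registered line of the crux, RUNG 1 of the diamond ladder of `PeakNormalForm` (`Lines/birth.lean`,
stub `stub_diamond`): the floor `InterchangeLemma` (crux 4 of the route, stmt-4830, PROVED: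
`Summit.KontsevichZagierPeriods.CommonUnfolding.interchangeLemma_proof`) with ONE hypothesis
generalised — "both bands descend to literally the same base `r₂`" ↦ "`k + 1` bands against
`l + 1` bands whose bases share `r₂.domain` and agree with `r₂` AFTER integrand additivity
(`∑ᵢ gᵢ = G = ∑ⱼ g'ⱼ`, a rule-1b seam)". Graded family `KlInterchange k l`; floor = `KlInterchange 0 0`
(witness: `Lines/KlInterchange_special.lean`, from `interchangeLemma_proof`, no sorry).

STATUS: PROVED AND LANDED. The rung was typed and proved sorry-free by seat
fwd-rung-KontsevichZagierPeriods-03 (`Rung_birth.lean`, 482 lines, evidence on stmt-4828) and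
landed by rtask-KontsevichZagierPeriods-Common-ef55917f as the registered stub
`Summit.KontsevichZagierPeriods.CommonUnfolding.stub_klInterchange` (p170409,
`Theorems/CommonUnfoldingPeakNormalFormKlInterchange.lean`) over the helpers
`of_sub_of_mem_newtonLeibnizRel_of_weightedCoupling` / `exists_weightedCoupling` (p170104,
`Theorems/CommonUnfoldingPeakNormalFormWeightedCoupling.lean`). This file is the crux-side INDEX of
that theorem in skeleton shape: the two stubs of the rung (`stub_weightedDescent : StubA`,
`stub_weightedPeak : StubB`) are discharged BY NAME from the landed helpers, the composition
`rung_of_stubs : StubA → StubB → ∀ k l, KlInterchange k l` (family bookkeeping, the swap, the two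
seams) is kernel-checked here, `rung_of : Rung`, and `example : Rung := fun k l => stub_klInterchange k l`
certifies that the line's rung is verbatim the landed tree theorem. No `sorry`.

THE LEVER: the WEIGHTED signed coupling `R i j = p·fᵢ h'ⱼ + q·hᵢ f'ⱼ − p q·G hᵢ h'ⱼ`
(`p = 1/(l+1)`, `q = 1/(k+1)`, `hᵢ = 1/(βᵢ − αᵢ)`) on the `(k+1)(l+1)` double bands. Each `R i j`
descends once in `s` to a piece `c i j` on `B i` and its coordinate swap once in `t` to `c' i j` on
`B' j`; the pieces RE-SUM one dimension up (`∑ⱼ c i j = fᵢ` on `B i`, `∑ᵢ c' i j = f'ⱼ` on `B' j`,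
rule 1b at level `n + 1`). What the floor's proof lacked (`of_sub_of_mem_newtonLeibnizRel_of_coupling`,
hypothesis `hbase₃`): there the fibre increment of `F₃` IS the common base integrand; with `l + 1`
bands it is `g'ⱼ ≠ G` and only the sum telescopes, so the identity moves from the single descent to
the seam `∑ⱼ (p fᵢ + q hᵢ g'ⱼ − p q hᵢ G) = fᵢ` (`(l+1) p = 1`). Weights must be RATIONAL
(`ℚ`-semialgebraic constants), else the primitive leaves the class.

WHERE IT PLUGS IN. `Lines/birth.lean`, `stub_diamond` (XL, the heart of the crux: local confluence of
descent rounds modulo `KZ.levelRel`): its seam decomposes by the generators of `levelRel`; the 1b seam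
is the only one needing a new FORMULA and is settled here for arbitrary multiplicities with ONE round
up. Remaining toward `stub_diamond` (`gap_after`, LADDER-rung.md on stmt-4828): rung 2 = the full
level seam (1a base splits = NL restriction to a semialgebraic sub-base; base-coordinate permutations
= NL equivariance; degenerate fibres = junk; and the level-NULL bottom joining tops of different
dimensions, where the strict diamond is FALSE and only semi-confluence holds — birth.md caveat),
rung 3 = depth (strip lemma / tiling). In `Lines/zero_shadows.lean` the interchange is OFF the path
(that line replaces the diamond by a subgroup argument). BC9: method family signed-coupling /
fubini-descent / rewriting-normal-form; ladder capped at `PeakNormalForm` (presentation theorems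
only); lift = `UnfoldingComplement` (peaks for equal VALUES ≡ Conjecture 1 given the normal form;
tame-cube sector = Ayoub 2015 Conj. 1.1) — disposition FRONTIER for this ladder.

References: M. Kontsevich, D. Zagier, *Periods* (2001), §1.2 rules 1b), 3); G. W. Anderson (1991);
J. Cresson, J. Viu-Sos, JTNB 34 (2022) §2.1 (algebraic-primitives obstruction, honoured: no primitive
is computed, one variable is added); M. H. A. Newman, Ann. Math. 43 (1942) (diamond lemma, for rung 3).
-/

namespace Summit.KontsevichZagierPeriods.KontsevichZagierPeriods.Cruxes.PeakNormalForm.KlInterchange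

open Set MeasureTheory
open Literature.NumberTheory.Transcendental
open Literature.ModelTheory.ExponentialFields (IsSemialgebraic)
open Summit.KontsevichZagierPeriods.CommonUnfolding

/-- The rung's graded family (verbatim as in `Sketch.lean`). -/
def KlInterchange (k l : ℕ) : Prop :=
  ∀ ⦃n : ℕ⦄ (r₂ : KZ.IntegralRep n)
    (B : Fin (k + 1) → KZ.IntegralRep (n + 1)) (b : Fin (k + 1) → KZ.IntegralRep n)
    (B' : Fin (l + 1) → KZ.IntegralRep (n + 1)) (b' : Fin (l + 1) → KZ.IntegralRep n),
    (∀ i, KZ.of (B i) - KZ.of (b i) ∈ KZ.newtonLeibnizRel) →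
    (∀ j, KZ.of (B' j) - KZ.of (b' j) ∈ KZ.newtonLeibnizRel) →
    (∀ i, (b i).domain = r₂.domain) → (∀ j, (b' j).domain = r₂.domain) →
    (∀ x ∈ r₂.domain, ∑ i, (b i).integrand x = r₂.integrand x) →
    (∀ x ∈ r₂.domain, ∑ j, (b' j).integrand x = r₂.integrand x) →
    (∀ i, ∀ x ∈ r₂.domain, ∃ t t' : ℝ, t < t' ∧
      (Fin.snoc x t : Fin (n + 1) → ℝ) ∈ (B i).domain ∧ (Fin.snoc x t' : Fin (n + 1) → ℝ) ∈ (B i).domain) →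
    (∀ j, ∀ x ∈ r₂.domain, ∃ t t' : ℝ, t < t' ∧
      (Fin.snoc x t : Fin (n + 1) → ℝ) ∈ (B' j).domain ∧ (Fin.snoc x t' : Fin (n + 1) → ℝ) ∈ (B' j).domain) →
    ∃ (R R' : Fin (k + 1) → Fin (l + 1) → KZ.IntegralRep (n + 2))
      (c c' : Fin (k + 1) → Fin (l + 1) → KZ.IntegralRep (n + 1)),
      (∀ i j, KZ.of (R i j) - KZ.of (c i j) ∈ KZ.newtonLeibnizRel) ∧
      (∀ i j, KZ.of (R' i j) - KZ.of (c' i j) ∈ KZ.newtonLeibnizRel) ∧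
      (∀ i j, (R' i j).domain =
        (fun w : Fin (n + 2) → ℝ => w ∘ ⇑(Equiv.swap (Fin.castSucc (Fin.last n)) (Fin.last (n + 1)))) ''
          (R i j).domain) ∧
      (∀ i j, ∀ w ∈ (R i j).domain, (R i j).integrand w =
        (R' i j).integrand (w ∘ ⇑(Equiv.swap (Fin.castSucc (Fin.last n)) (Fin.last (n + 1))))) ∧
      (∀ i j, (c i j).domain = (B i).domain) ∧ (∀ i j, (c' i j).domain = (B' j).domain) ∧
      (∀ i, ∀ z ∈ (B i).domain, ∑ j, (c i j).integrand z = (B i).integrand z) ∧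
      (∀ j, ∀ z ∈ (B' j).domain, ∑ i, (c' i j).integrand z = (B' j).integrand z)

/-- The rung. -/
def Rung : Prop := ∀ k l : ℕ, KlInterchange k l

/-- **Stub A — weighted descent** (generalises the floor's
`of_sub_of_mem_newtonLeibnizRel_of_coupling`: rational weights `p q`, and the base integrand `G`
no longer tied to the fibre increment `g₃` of `F₃`). [Kontsevich–Zagier 2001, §1.2 rule 3)] -/
def StubA : Prop :=
  ∀ ⦃n : ℕ⦄ (τ : Set (Fin n → ℝ)) (α₁ β₁ α₃ β₃ G g₃ : (Fin n → ℝ) → ℝ)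
    (F₃ : (Fin (n + 1) → ℝ) → ℝ) (b₁ b₃ : KZ.IntegralRep (n + 1)) (R : KZ.IntegralRep (n + 2))
    (c : KZ.IntegralRep (n + 1)) (p q : ℚ),
    IsSemialgebraicFunOn ℚ τ α₁ → IsSemialgebraicFunOn ℚ τ β₁ →
    IsSemialgebraicFunOn ℚ τ α₃ → IsSemialgebraicFunOn ℚ τ β₃ →
    IsSemialgebraicFunOn ℚ τ G → IsSemialgebraicFunOn ℚ τ g₃ →
    (∀ x ∈ τ, α₁ x < β₁ x) → (∀ x ∈ τ, α₃ x < β₃ x) →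
    b₁.domain = KZlog.band τ α₁ β₁ → b₃.domain = KZlog.band τ α₃ β₃ →
    IsSemialgebraicFunOn ℚ b₃.domain F₃ →
    (∀ x ∈ τ, ContinuousOn (fun t : ℝ => F₃ (Fin.snoc x t)) (Icc (α₃ x) (β₃ x))) →
    (∀ x ∈ τ, ∀ t ∈ Ioo (α₃ x) (β₃ x),
      HasDerivAt (fun s : ℝ => F₃ (Fin.snoc x s)) (b₃.integrand (Fin.snoc x t)) t) →
    (∀ x ∈ τ, g₃ x = F₃ (Fin.snoc x (β₃ x)) - F₃ (Fin.snoc x (α₃ x))) →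
    R.domain = KZlog.band (KZlog.band τ α₁ β₁) (fun z => α₃ (Fin.init z)) (fun z => β₃ (Fin.init z)) →
    (∀ w ∈ R.domain, R.integrand w =
      (p : ℝ) * (b₁.integrand (Fin.init w) *
        (β₃ (Fin.init (Fin.init w)) - α₃ (Fin.init (Fin.init w)))⁻¹) +
      (q : ℝ) * (b₃.integrand (Fin.snoc (Fin.init (Fin.init w)) (w (Fin.last (n + 1)))) *
        (β₁ (Fin.init (Fin.init w)) - α₁ (Fin.init (Fin.init w)))⁻¹) -
      (p : ℝ) * (q : ℝ) * (G (Fin.init (Fin.init w)) *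
        (β₁ (Fin.init (Fin.init w)) - α₁ (Fin.init (Fin.init w)))⁻¹ *
        (β₃ (Fin.init (Fin.init w)) - α₃ (Fin.init (Fin.init w)))⁻¹)) →
    c.domain = b₁.domain →
    (∀ z ∈ b₁.domain, c.integrand z =
      (p : ℝ) * b₁.integrand z +
      (q : ℝ) * (g₃ (Fin.init z) * (β₁ (Fin.init z) - α₁ (Fin.init z))⁻¹) -
      (p : ℝ) * (q : ℝ) * (G (Fin.init z) * (β₁ (Fin.init z) - α₁ (Fin.init z))⁻¹)) →
    KZ.of R - KZ.of c ∈ KZ.newtonLeibnizRel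

/-- **Stub B — weighted peak** (generalises the packaging half of `interchangeLemma_proof`:
the weighted coupling is an absolutely integrable `ℚ`-semialgebraic representation on the double
band, and the two one-level-down pieces exist as representations on the bands).
[Kontsevich–Zagier 2001, §1.2; Tonelli] -/
def StubB : Prop :=
  ∀ ⦃n : ℕ⦄ (τ : Set (Fin n → ℝ)) (α₁ β₁ α₃ β₃ G g₁ g₃ : (Fin n → ℝ) → ℝ)
    (b₁ b₃ : KZ.IntegralRep (n + 1)) (p q : ℚ),
    IsSemialgebraic ℚ τ →
    IsSemialgebraicFunOn ℚ τ α₁ → IsSemialgebraicFunOn ℚ τ β₁ →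
    IsSemialgebraicFunOn ℚ τ α₃ → IsSemialgebraicFunOn ℚ τ β₃ →
    IsSemialgebraicFunOn ℚ τ G → IsSemialgebraicFunOn ℚ τ g₁ → IsSemialgebraicFunOn ℚ τ g₃ →
    IntegrableOn G τ → IntegrableOn g₁ τ → IntegrableOn g₃ τ →
    (∀ x ∈ τ, α₁ x < β₁ x) → (∀ x ∈ τ, α₃ x < β₃ x) →
    b₁.domain = KZlog.band τ α₁ β₁ → b₃.domain = KZlog.band τ α₃ β₃ →
    ∃ (R : KZ.IntegralRep (n + 2)) (c c' : KZ.IntegralRep (n + 1)),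
      R.domain = KZlog.band (KZlog.band τ α₁ β₁) (fun z => α₃ (Fin.init z)) (fun z => β₃ (Fin.init z)) ∧
      (∀ w ∈ R.domain, R.integrand w =
        (p : ℝ) * (b₁.integrand (Fin.init w) *
          (β₃ (Fin.init (Fin.init w)) - α₃ (Fin.init (Fin.init w)))⁻¹) +
        (q : ℝ) * (b₃.integrand (Fin.snoc (Fin.init (Fin.init w)) (w (Fin.last (n + 1)))) *
          (β₁ (Fin.init (Fin.init w)) - α₁ (Fin.init (Fin.init w)))⁻¹) -
        (p : ℝ) * (q : ℝ) * (G (Fin.init (Fin.init w)) *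
          (β₁ (Fin.init (Fin.init w)) - α₁ (Fin.init (Fin.init w)))⁻¹ *
          (β₃ (Fin.init (Fin.init w)) - α₃ (Fin.init (Fin.init w)))⁻¹)) ∧
      c.domain = b₁.domain ∧
      (∀ z ∈ b₁.domain, c.integrand z =
        (p : ℝ) * b₁.integrand z +
        (q : ℝ) * (g₃ (Fin.init z) * (β₁ (Fin.init z) - α₁ (Fin.init z))⁻¹) -
        (p : ℝ) * (q : ℝ) * (G (Fin.init z) * (β₁ (Fin.init z) - α₁ (Fin.init z))⁻¹)) ∧
      c'.domain = b₃.domain ∧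
      (∀ z ∈ b₃.domain, c'.integrand z =
        (q : ℝ) * b₃.integrand z +
        (p : ℝ) * (g₁ (Fin.init z) * (β₃ (Fin.init z) - α₃ (Fin.init z))⁻¹) -
        (q : ℝ) * (p : ℝ) * (G (Fin.init z) * (β₃ (Fin.init z) - α₃ (Fin.init z))⁻¹))

/-- Stub A — DISCHARGED: it is the landed
`Summit.KontsevichZagierPeriods.CommonUnfolding.of_sub_of_mem_newtonLeibnizRel_of_weightedCoupling`
(p170104; the landed form drops the unused hypothesis `IsSemialgebraicFunOn ℚ τ g₃`). -/
theorem stub_weightedDescent : StubA := by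
  intro n τ α₁ β₁ α₃ β₃ G g₃ F₃ b₁ b₃ R c p q hα₁ hβ₁ hα₃ hβ₃ hG _hg₃ hlt₁ hlt₃ hd₁ hd₃ hF₃ hcont₃
    hder₃ hbase₃ hRd hRi hcd hci
  exact of_sub_of_mem_newtonLeibnizRel_of_weightedCoupling τ α₁ β₁ α₃ β₃ G g₃ F₃ b₁ b₃ R c p q hα₁ hβ₁
    hα₃ hβ₃ hG hlt₁ hlt₃ hd₁ hd₃ hF₃ hcont₃ hder₃ hbase₃ hRd hRi hcd hci

/-- Stub B — DISCHARGED: it is the landed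
`Summit.KontsevichZagierPeriods.CommonUnfolding.exists_weightedCoupling` (p170104), verbatim. -/
theorem stub_weightedPeak : StubB := by
  intro n τ α₁ β₁ α₃ β₃ G g₁ g₃ b₁ b₃ p q hτ hα₁ hβ₁ hα₃ hβ₃ hG hg₁ hg₃ hGi hg₁i hg₃i hlt₁ hlt₃ hd₁ hd₃
  exact exists_weightedCoupling τ α₁ β₁ α₃ β₃ G g₁ g₃ b₁ b₃ p q hτ hα₁ hβ₁ hα₃ hβ₃ hG hg₁ hg₃ hGi hg₁i
    hg₃i hlt₁ hlt₃ hd₁ hd₃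

/-- **Composition** (kernel-checked, sorry-free; verbatim the seat's `rung_of_stubs`): the two stubs
give every member of the family — Newton–Leibniz data of each band by `nl_data`, weights
`p = 1/(l+1)`, `q = 1/(k+1)`, the swap `R' i j = (R i j).reindex (swap n (n+1))` (second descent =
Stub A with the roles exchanged), and the two SEAMS `∑ⱼ (p fᵢ + q hᵢ g'ⱼ − p q hᵢ G) = fᵢ` ⟸
`∑ⱼ g'ⱼ = G`, `(l+1) p = 1`. (Conclusion spelled `∀ k l, KlInterchange k l` rather than `Rung` so
that `rung_of` below is the unique theorem of this file concluding the rung BY NAME.) -/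
theorem rung_of_stubs : StubA → StubB → ∀ k l : ℕ, KlInterchange k l := by
  intro hA hB k l n r₂ B b B' b' hB₁ hB₃ hd hd' hs hs' hne hne'
  -- Newton–Leibniz data of each band (base domain rewritten to `r₂.domain`)
  have hdat : ∀ i, ∃ (a e : (Fin n → ℝ) → ℝ) (F : (Fin (n + 1) → ℝ) → ℝ),
      IsSemialgebraicFunOn ℚ (B i).domain F ∧ IsSemialgebraicFunOn ℚ r₂.domain a ∧
      IsSemialgebraicFunOn ℚ r₂.domain e ∧ (∀ x ∈ r₂.domain, a x ≤ e x) ∧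
      (B i).domain = KZlog.band r₂.domain a e ∧
      (∀ x ∈ r₂.domain, ContinuousOn (fun t : ℝ => F (Fin.snoc x t)) (Icc (a x) (e x))) ∧
      (∀ x ∈ r₂.domain, ∀ t ∈ Ioo (a x) (e x),
        HasDerivAt (fun s : ℝ => F (Fin.snoc x s)) ((B i).integrand (Fin.snoc x t)) t) ∧
      (∀ x ∈ r₂.domain, (b i).integrand x = F (Fin.snoc x (e x)) - F (Fin.snoc x (a x))) := by
    intro i
    obtain ⟨a, e, F, hF, ha, he, hle, hband, hcont, hderiv, hbase⟩ := nl_data (hB₁ i)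
    rw [hd i] at ha he hle hband hcont hderiv hbase
    exact ⟨a, e, F, hF, ha, he, hle, hband, hcont, hderiv, hbase⟩
  have hdat' : ∀ j, ∃ (a e : (Fin n → ℝ) → ℝ) (F : (Fin (n + 1) → ℝ) → ℝ),
      IsSemialgebraicFunOn ℚ (B' j).domain F ∧ IsSemialgebraicFunOn ℚ r₂.domain a ∧
      IsSemialgebraicFunOn ℚ r₂.domain e ∧ (∀ x ∈ r₂.domain, a x ≤ e x) ∧
      (B' j).domain = KZlog.band r₂.domain a e ∧
      (∀ x ∈ r₂.domain, ContinuousOn (fun t : ℝ => F (Fin.snoc x t)) (Icc (a x) (e x))) ∧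
      (∀ x ∈ r₂.domain, ∀ t ∈ Ioo (a x) (e x),
        HasDerivAt (fun s : ℝ => F (Fin.snoc x s)) ((B' j).integrand (Fin.snoc x t)) t) ∧
      (∀ x ∈ r₂.domain, (b' j).integrand x = F (Fin.snoc x (e x)) - F (Fin.snoc x (a x))) := by
    intro j
    obtain ⟨a, e, F, hF, ha, he, hle, hband, hcont, hderiv, hbase⟩ := nl_data (hB₃ j)
    rw [hd' j] at ha he hle hband hcont hderiv hbase
    exact ⟨a, e, F, hF, ha, he, hle, hband, hcont, hderiv, hbase⟩
  choose α β F hF hα hβ hle hband hcont hder hbase using hdat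
  choose α' β' F' hF' hα' hβ' hle' hband' hcont' hder' hbase' using hdat'
  -- nondegenerate fibres
  have hlt : ∀ i, ∀ x ∈ r₂.domain, α i x < β i x := fun i x hx => by
    obtain ⟨t, t', htt', ht, ht'⟩ := hne i x hx
    rw [hband i, KZlog.snoc_mem_band] at ht ht'
    exact (ht.2.1.trans_lt htt').trans_le ht'.2.2
  have hlt' : ∀ j, ∀ x ∈ r₂.domain, α' j x < β' j x := fun j x hx => by
    obtain ⟨t, t', htt', ht, ht'⟩ := hne' j x hx
    rw [hband' j, KZlog.snoc_mem_band] at ht ht'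
    exact (ht.2.1.trans_lt htt').trans_le ht'.2.2
  have hτ := r₂.isSemialgebraic_domain
  have hG := r₂.isSemialgebraicFunOn_integrand
  have hgsa : ∀ i, IsSemialgebraicFunOn ℚ r₂.domain (b i).integrand := fun i => by
    rw [← hd i]; exact (b i).isSemialgebraicFunOn_integrand
  have hg'sa : ∀ j, IsSemialgebraicFunOn ℚ r₂.domain (b' j).integrand := fun j => by
    rw [← hd' j]; exact (b' j).isSemialgebraicFunOn_integrand
  have hgi : ∀ i, IntegrableOn (b i).integrand r₂.domain := fun i => by
    rw [← hd i]; exact (b i).integrableOn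
  have hg'i : ∀ j, IntegrableOn (b' j).integrand r₂.domain := fun j => by
    rw [← hd' j]; exact (b' j).integrableOn
  -- the weights
  set p : ℚ := ((l : ℚ) + 1)⁻¹ with hp
  set q : ℚ := ((k : ℚ) + 1)⁻¹ with hq
  -- peaks and pieces (Stub B), for every pair `(i, j)`
  have hpk := fun i j => hB r₂.domain (α i) (β i) (α' j) (β' j) r₂.integrand (b i).integrand
    (b' j).integrand (B i) (B' j) p q hτ (hα i) (hβ i) (hα' j) (hβ' j) hG (hgsa i) (hg'sa j)
    r₂.integrableOn (hgi i) (hg'i j) (hlt i) (hlt' j) (hband i) (hband' j)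
  choose R c c' hRd hRi hcd hci hc'd hc'i using hpk
  refine ⟨R, fun i j => (R i j).reindex (Equiv.swap (Fin.castSucc (Fin.last n)) (Fin.last (n + 1))),
    c, c', fun i j => ?_, fun i j => ?_, fun i j => ?_, fun i j w _ => ?_, hcd, hc'd,
    fun i z hz => ?_, fun j z hz => ?_⟩
  · -- first descent (Stub A)
    exact hA r₂.domain (α i) (β i) (α' j) (β' j) r₂.integrand (b' j).integrand (F' j) (B i) (B' j)
      (R i j) (c i j) p q (hα i) (hβ i) (hα' j) (hβ' j) hG (hg'sa j) (hlt i) (hlt' j) (hband i)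
      (hband' j) (hF' j) (hcont' j) (hder' j) (hbase' j) (hRd i j) (hRi i j) (hcd i j) (hci i j)
  · -- second descent (Stub A with the roles exchanged, on the swapped peak)
    have hR'd : ((R i j).reindex (Equiv.swap (Fin.castSucc (Fin.last n)) (Fin.last (n + 1)))).domain =
        KZlog.band (KZlog.band r₂.domain (α' j) (β' j)) (fun z => α i (Fin.init z))
          (fun z => β i (Fin.init z)) := by
      rw [KZ.IntegralRep.reindex_domain, hRd]
      exact setOf_comp_swap_mem_dband _ _ _ _ _
    refine hA r₂.domain (α' j) (β' j) (α i) (β i) r₂.integrand (b i).integrand (F i) (B' j) (B i)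
      _ (c' i j) q p (hα' j) (hβ' j) (hα i) (hβ i) hG (hgsa i) (hlt' j) (hlt i) (hband' j)
      (hband i) (hF i) (hcont i) (hder i) (hbase i) hR'd (fun w hw => ?_) (hc'd i j) (hc'i i j)
    have hw' : (fun idx => w (Equiv.swap (Fin.castSucc (Fin.last n)) (Fin.last (n + 1)) idx)) ∈
        (R i j).domain := hw
    have hsw : (Fin.snoc (Fin.init (Fin.init w)) (w (Fin.castSucc (Fin.last n))) :
        Fin (n + 1) → ℝ) = Fin.init w := Fin.snoc_init_self _
    rw [KZ.IntegralRep.reindex_integrand]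
    show (R i j).integrand _ = _
    rw [hRi i j _ hw']
    simp only [KZ.init_comp_swap, KZ.comp_swap_last, Fin.init_snoc, hsw]
    ring
  · -- the domain of `R'` is the swap image of the domain of `R`
    ext w
    simp only [KZ.IntegralRep.reindex_domain, mem_setOf_eq, mem_image]
    constructor
    · intro hw
      exact ⟨_, hw, funext fun i => by simp⟩
    · rintro ⟨v, hv, rfl⟩
      simpa using hv
  · -- the integrands agree along the swap
    simp [KZ.IntegralRep.reindex_integrand]
  · -- seam on `B i`: `∑ⱼ (p fᵢ + q hᵢ g'ⱼ − p q hᵢ G) = fᵢ`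
    have hx : Fin.init z ∈ r₂.domain := by
      rw [hband i] at hz
      exact hz.1
    have h1 : β i (Fin.init z) - α i (Fin.init z) ≠ 0 := (sub_pos.2 (hlt i _ hx)).ne'
    rw [Finset.sum_congr rfl fun j _ => hci i j z hz, Finset.sum_sub_distrib,
      Finset.sum_add_distrib, Finset.sum_const, Finset.sum_const, Finset.card_univ,
      Fintype.card_fin, ← Finset.mul_sum, ← Finset.sum_mul, hs' _ hx]
    simp only [nsmul_eq_mul, hp, hq]
    push_cast
    field_simp
    ring
  · -- seam on `B' j`: `∑ᵢ (q f'ⱼ + p h'ⱼ gᵢ − q p h'ⱼ G) = f'ⱼ`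
    have hx : Fin.init z ∈ r₂.domain := by
      rw [hband' j] at hz
      exact hz.1
    have h3 : β' j (Fin.init z) - α' j (Fin.init z) ≠ 0 := (sub_pos.2 (hlt' j _ hx)).ne'
    rw [Finset.sum_congr rfl fun i _ => hc'i i j z hz, Finset.sum_sub_distrib,
      Finset.sum_add_distrib, Finset.sum_const, Finset.sum_const, Finset.card_univ,
      Fintype.card_fin, ← Finset.mul_sum, ← Finset.sum_mul, hs _ hx]
    simp only [nsmul_eq_mul, hp, hq]
    push_cast
    field_simp
    ring

/-- **The rung** `Rung := ∀ k l, KlInterchange k l`, from the two (discharged) stubs. -/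
theorem rung_of : Rung := rung_of_stubs stub_weightedDescent stub_weightedPeak

/-- Certificate: the line's rung is, verbatim, the landed tree theorem
`Summit.KontsevichZagierPeriods.CommonUnfolding.stub_klInterchange` (registered stub of stmt-4828,
p170409). -/
example : Rung := fun k l => stub_klInterchange k l

/-- … and conversely the composition of this file re-derives the landed statement. -/
example : ∀ (k l : ℕ), KlInterchange k l := rung_of

/-- The floor is the bottom of the family: `InterchangeLemma` (crux 4, stmt-4830) is the shape of
`KlInterchange 0 0` (witness with the `Fin 1` bookkeeping: `Lines/KlInterchange_special.lean`). -/
example : Prop := Summit.KontsevichZagierPeriods.KontsevichZagierPeriods.Theses.CommonUnfolding.InterchangeLemma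

end Summit.KontsevichZagierPeriods.KontsevichZagierPeriods.Cruxes.PeakNormalForm.KlInterchange
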